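import Mathlib
import Summits.NavierStokesRegularity.NavierStokesRegularity.Theorems.TaoLadderRungTwoBreakOneShiftFrameRowsTop
import HarnessLib

/-!
# Kernel STAGE 3, frame envelopes: the two elementary envelope facts a concrete geometric frame needs
# (cell harvest/h2-tao-ladder, seat p2; rung1/KERNEL-STAGE3-PLAN.md brick (9) toolkit; support for K1(1) =
# `NoSurvivingDSSOne`, stmt-NavierStokesRegularity-20205)

MODEL lattices; nothing about the Navier–Stokes equations; no item closed; elementary real inequalities.
* `affineGeom_le_geom` — `(c₀ + c₁ j) ξ^j ≤ (c₀ + c₁/δ) (ξ(1+δ))^j` (Bernoulli: `1 + jδ ≤ (1+δ)^j`): turns STAGE 2's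
  affine-geometric wake radii `ĝ^j (r̃₁ + κ j)`-type amplitudes into a geometric envelope `ā β^j` with `β = ξ(1+δ)`
  as close to `ξ` as desired (the frame-row lemmas need `β ≤ θ = ĝζ′` and `β² < gΛ`);
* `rateExpr_top_le` — the top analogue of `rateExpr_wake_le` (module `…OneShiftFrameRates`, p625188): with `0 ≤ A_{W-1+j} ≤ ā_t ϑ_A^j`
  (`0 < ϑ_A ≤ 1`, `Λ ≥ 1`) the rate expression at `k = W+j` is at most `4 m² M_α ā_t² Λ^{W} ϑ_A⁻² · (Λ ϑ_A²)^j`… stated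
  in the division-free form `4 m² M_α ā_t² Λ^{W+j} ϑ_A^{2j}`.
-/

noncomputable section

-- `Summit.NavierStokesRegularity.NavierStokesRegularity.…` is the tree's (summit = problem) namespace; the
-- duplicated component is intended, so the dupNamespace linter is silenced for this file.
set_option linter.dupNamespace false

namespace Summit.NavierStokesRegularity.NavierStokesRegularity.Theorems

namespace DSSOneShift

open Set
open Literature.Analysis.FluidPDE Literature.Analysis.FluidPDE.TaoCascade

variable {m : ℕ}

namespace OneShiftFrame

/-- **Affine-geometric under geometric.** For `c₀, c₁ ≥ 0`, `ξ ≥ 0`, `δ > 0` and every `j`: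
`(c₀ + c₁ j) ξ^j ≤ (c₀ + c₁/δ) (ξ (1+δ))^j` (since `j δ ≤ (1+δ)^j`). [folklore (Bernoulli's inequality)] -/
theorem affineGeom_le_geom {c₀ c₁ ξ δ : ℝ} (hc₀ : 0 ≤ c₀) (hc₁ : 0 ≤ c₁) (hξ : 0 ≤ ξ) (hδ : 0 < δ) (j : ℕ) :
    (c₀ + c₁ * j) * ξ ^ j ≤ (c₀ + c₁ / δ) * (ξ * (1 + δ)) ^ j := by
  have hB : 1 + (j : ℝ) * δ ≤ (1 + δ) ^ j := by
    have := one_add_mul_le_pow (show (-2 : ℝ) ≤ δ by linarith) j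
    simpa [mul_comm] using this
  have h1 : (j : ℝ) ≤ (1 + δ) ^ j / δ := by
    rw [le_div_iff₀ hδ]; nlinarith
  have hpow : 1 ≤ (1 + δ) ^ j := one_le_pow₀ (by linarith)
  have hξj : 0 ≤ ξ ^ j := pow_nonneg hξ j
  rw [mul_pow]
  have h2 : c₀ + c₁ * j ≤ (c₀ + c₁ / δ) * (1 + δ) ^ j := by
    have : c₁ * (j : ℝ) ≤ c₁ / δ * (1 + δ) ^ j := by
      calc c₁ * (j : ℝ) ≤ c₁ * ((1 + δ) ^ j / δ) := mul_le_mul_of_nonneg_left h1 hc₁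
        _ = c₁ / δ * (1 + δ) ^ j := by ring
    nlinarith
  calc (c₀ + c₁ * j) * ξ ^ j ≤ (c₀ + c₁ / δ) * (1 + δ) ^ j * ξ ^ j := mul_le_mul_of_nonneg_right h2 hξj
    _ = (c₀ + c₁ / δ) * (ξ ^ j * (1 + δ) ^ j) := by ring

/-- **Top rate envelope.** With `0 ≤ A_{W-1+j} ≤ ā_t ϑ_A^j` for `j ≥ 0` (`0 < ϑ_A ≤ 1`; `j = 0` is the window's top
shell) and `Λ ≥ 1`, at `k = W + j`:
`m² M_α ((1+ε₀)^{5k/2}(A_k² + 2A_kA_{k+1}) + (1+ε₀)^{5(k-1)/2} A_{k-1}²) ≤ 4 m² M_α ā_t² Λ^{W+j} ϑ_A^{2j}`.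
[cite: Tao2016AveragedNS, §4 Lemma 4.1 (4.8); cell vocabulary, harvest/h2-tao-ladder rung1/STAGE2-LEMMA.md §3 Lemma 4(b)] -/
theorem rateExpr_top_le {ε₀ Mα abart ϑA : ℝ} (W : ℕ) (hε : 0 < 1 + ε₀) (hΛ1 : 1 ≤ bigLam ε₀)
    (hMα : 0 ≤ Mα) (hϑA0 : 0 < ϑA) (hϑA1 : ϑA ≤ 1) (habart : 0 ≤ abart) {A : ℤ → ℝ} (hAnn : ∀ k, 0 ≤ A k)
    (hA : ∀ j : ℕ, A ((W : ℤ) - 1 + j) ≤ abart * ϑA ^ j) (j : ℕ) :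
    (m : ℝ) ^ 2 * Mα * ((1 + ε₀) ^ ((5 : ℝ) * (((W : ℤ) + j : ℤ) : ℝ) / 2) *
        (A ((W : ℤ) + j) * A ((W : ℤ) + j) + 2 * (A ((W : ℤ) + j) * A ((W : ℤ) + j + 1))) +
      (1 + ε₀) ^ ((5 : ℝ) * ((((W : ℤ) + j : ℤ) : ℝ) - 1) / 2) * (A ((W : ℤ) + j - 1) * A ((W : ℤ) + j - 1))) ≤
      4 * (m : ℝ) ^ 2 * Mα * abart ^ 2 * (bigLam ε₀) ^ (W + j) * ϑA ^ (2 * j) := by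
  have hΛpos : 0 < bigLam ε₀ := bigLam_pos (by linarith)
  have hg1 : (1 + ε₀) ^ ((5 : ℝ) * (((W : ℤ) + j : ℤ) : ℝ) / 2) = (bigLam ε₀) ^ (W + j) := by
    rw [bigLam_zpow_eq_rpow hε, show ((W : ℤ) + j : ℤ) = ((W + j : ℕ) : ℤ) by push_cast; ring, zpow_natCast]
  have hg2 : (1 + ε₀) ^ ((5 : ℝ) * ((((W : ℤ) + j : ℤ) : ℝ) - 1) / 2) ≤ (bigLam ε₀) ^ (W + j) := by
    have e := bigLam_zpow_eq_rpow hε ((W : ℤ) + j - 1)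
    push_cast at e ⊢
    rw [e, show ((bigLam ε₀) ^ (W + j) : ℝ) = (bigLam ε₀) ^ (((W + j : ℕ) : ℤ)) by rw [zpow_natCast]]
    exact zpow_le_zpow_right₀ hΛ1 (by push_cast; linarith)
  -- amplitude envelopes at `W+j-1, W+j, W+j+1`, all under `ā_t ϑ_A^j`
  set B := abart * ϑA ^ j with hB
  have hB0 : 0 ≤ B := by positivity
  have hmono : ∀ {a b : ℕ}, a ≤ b → abart * ϑA ^ b ≤ abart * ϑA ^ a := fun hab =>
    mul_le_mul_of_nonneg_left (pow_le_pow_of_le_one hϑA0.le hϑA1 hab) habart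
  have hm' : A ((W : ℤ) + j - 1) ≤ B := by
    have h := hA j; rw [show ((W : ℤ) - 1 + j) = (W : ℤ) + j - 1 by ring] at h; exact h
  have h0 : A ((W : ℤ) + j) ≤ B := by
    have h := hA (j + 1); rw [show ((W : ℤ) - 1 + ((j + 1 : ℕ) : ℤ)) = (W : ℤ) + j by push_cast; ring] at h
    exact h.trans (hmono (by omega))
  have hp : A ((W : ℤ) + j + 1) ≤ B := by
    have h := hA (j + 2); rw [show ((W : ℤ) - 1 + ((j + 2 : ℕ) : ℤ)) = (W : ℤ) + j + 1 by push_cast; ring] at h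
    exact h.trans (hmono (by omega))
  have h3 : A ((W : ℤ) + j) * A ((W : ℤ) + j) + 2 * (A ((W : ℤ) + j) * A ((W : ℤ) + j + 1)) ≤ 3 * (B * B) := by
    nlinarith [mul_le_mul h0 h0 (hAnn _) hB0, mul_le_mul h0 hp (hAnn _) hB0]
  have h4 : A ((W : ℤ) + j - 1) * A ((W : ℤ) + j - 1) ≤ B * B := mul_le_mul hm' hm' (hAnn _) hB0
  have hK : 0 ≤ (m : ℝ) ^ 2 * Mα := by positivity
  have hL : 0 ≤ (bigLam ε₀) ^ (W + j) := pow_nonneg hΛpos.le _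
  have hg1' : 0 ≤ (1 + ε₀) ^ ((5 : ℝ) * ((((W : ℤ) + j : ℤ) : ℝ) - 1) / 2) := Real.rpow_nonneg hε.le _
  rw [hg1]
  calc (m : ℝ) ^ 2 * Mα * ((bigLam ε₀) ^ (W + j) *
          (A ((W : ℤ) + j) * A ((W : ℤ) + j) + 2 * (A ((W : ℤ) + j) * A ((W : ℤ) + j + 1))) +
        (1 + ε₀) ^ ((5 : ℝ) * ((((W : ℤ) + j : ℤ) : ℝ) - 1) / 2) * (A ((W : ℤ) + j - 1) * A ((W : ℤ) + j - 1)))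
      ≤ (m : ℝ) ^ 2 * Mα * ((bigLam ε₀) ^ (W + j) * (3 * (B * B)) + (bigLam ε₀) ^ (W + j) * (B * B)) := by
        refine mul_le_mul_of_nonneg_left (add_le_add ?_ ?_) hK
        · exact mul_le_mul_of_nonneg_left h3 hL
        · exact mul_le_mul hg2 h4 (mul_nonneg (hAnn _) (hAnn _)) hL
    _ = 4 * (m : ℝ) ^ 2 * Mα * abart ^ 2 * (bigLam ε₀) ^ (W + j) * ϑA ^ (2 * j) := by
        rw [hB]; ring

end OneShiftFrame

end DSSOneShift

end Summit.NavierStokesRegularity.NavierStokesRegularity.Theorems
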